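import Summits.BirchSwinnertonDyer.BirchSwinnertonDyer.Theorems.ByReductionTypeAtTwoSupersingularFlatBlindTwistedExactControl
import Summits.BirchSwinnertonDyer.Rank1Residual.X11b.CongruentSelmerTransferTransport
import Literature.NumberTheory.EllipticCurves.IwasawaSelmerDualProofs
import HarnessLib

/-!
# Route `ByReductionTypeAtTwo` (rung K4), crux `SupersingularRankZeroAtTwo` (item stmt-BirchSwinnertonDyer-19097), line
# `odd_blind_package` slot 5 (CDC `OddBlindPackage.FlatBlindControlCardAtTwo`, → CDC_H): steps 1 and 3 of the CDC road —
# **`#T = #T[2^J]` for `J ≫ 0`, and the TRANSPORT of the exact-control count to the twist side `W₂[2^J]`**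
# (cell `bsd-2adic`, LEAD ss-1 GEN 21; memo `HOME/ss/gen21/HAND-TARGETS-CDC-2.md` §1 steps 1–3)

HONEST FRAMING: THEOREMS ONLY (no definition, no named fact, no `sorry`, no instance); a helper
(`--supports stmt-BirchSwinnertonDyer-19097`): it does NOT prove CDC, CDC_H or the crux; nothing booked; BSD is proved for no curve
by any of this. bears_on: K4 (19097).

## What is proved

* `exists_forall_natCard_torsionBy_pow_eq` (generic): a FINITE abelian group all of whose elements are killed by powers of `p` equals its
  `p^J`-torsion for every large `J`: `∃ J₀, ∀ J ≥ J₀, #A[p^J] = #A`.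
* `exists_forall_natCard_torsionBy_endInvariants_eq` (step 1): for `T = Sel♭(E/ℚ_∞)[γ+1] = endInvariants (conjSharpFlatSelmerInfty … .flat γ + 1)`,
  finite ⟹ `∃ J₀, ∀ J ≥ J₀, #T[2^J] = #T` (`T ≤ H¹(ℚ_∞, E[2^∞])` is `2`-primary: `exists_pow_smul_subgroupH1_ker_eq_zero`).
* ★ `natCard_torsionBy_endInvariants_eq_natCard_selmerGroup_transport` (steps 2+3): for every level `J` and every pair of mutually
  inverse intertwiners `φ : W₂[2^J] ⇄ E[2^J](χ₋₁) : ψ` (tower-1 ★ p811113 `FlatBlindTwistSide.exists_intertwining_twist` supplies one for the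
  quadratic twist `W₂` of `E` by `2`), `#T[2^J] = #H¹_{𝓑_J[ψ]}(ℚ, W₂[2^J])` where `𝓑_J[ψ]` is the exact structure `𝓕♭ex_J` of HT-C1
  TRANSPORTED along `ψ` place by place (`𝓑_J[ψ] v = (𝓕♭ex_J v).map H¹(ψ_v)`): HT-C1 (t42 ★ `OddBlindTwist.HTC1_…`, `#T[2^J] = #H¹_{𝓕♭ex_J}`)
  and X11b's transport of Selmer groups along an isomorphism (`CongruentTransfer.natCard_selmerGroup_of_transport`). The W₂-side structure is
  a parameter `𝓑` with the pointwise transport equation `h𝓑` (so any spelling — a `match` literal, an intrinsic W₂-description proved equal —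
  is served by `rfl`/the dictionary).

References: [GreenbergLNM1716] §4 pp. 107, 122–124; [MazurRubin2004] Lemma 3.5.3 / [MazurRubin2010] Lemma 3.2 (transport of Selmer
structures along an isomorphism of Galois modules); [Sprung2012] Def. 7.11.
-/

set_option autoImplicit false
set_option linter.dupNamespace false

noncomputable section

open scoped Classical NumberField AddSubgroup ContRepresentation

namespace Summit.BirchSwinnertonDyer.BirchSwinnertonDyer.Theorems

namespace OddBlindLocal

open NumberField IsDedekindDomain Field WeierstrassCurve Literature.NumberTheory.EllipticCurves
  Literature.NumberTheory.EllipticCurves.IwasawaDual Literature.NumberTheory.GaloisRepresentations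
  Literature.NumberTheory.GaloisCohomology ZpExtension Literature.NumberTheory.EllipticCurves.Kobayashi2003
  Literature.NumberTheory.EllipticCurves.Sprung2017 Literature.NumberTheory.EllipticCurves.Sprung2012
  Literature.NumberTheory.EllipticCurves.Rank1Residual
open Literature.NumberTheory.GaloisRepresentations.DiscreteGaloisModule (SelmerStructure)
open Summit.BirchSwinnertonDyer.Rank1Residual.X11b

universe u

/-! ## §1 A finite `p`-primary group is its own `p^J`-torsion for `J ≫ 0` -/

/-- **A finite abelian group killed elementwise by powers of `p` IS its `p^J`-torsion for every large `J`**: with `N` a common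
exponent (`p^N · A = 0`, from finiteness), `A[p^J] = A` for `J ≥ N`, so `#A[p^J] = #A`. [folklore] -/
theorem exists_forall_natCard_torsionBy_pow_eq {A : Type*} [AddCommGroup A] [Finite A] (p : ℕ)
    (hA : ∀ a : A, ∃ n : ℕ, p ^ n • a = 0) :
    ∃ J₀ : ℕ, ∀ J : ℕ, J₀ ≤ J → Nat.card (A[((p ^ J : ℕ) : ℤ)]) = Nat.card A := by
  haveI : Fintype A := Fintype.ofFinite A
  choose n hn using hA
  refine ⟨Finset.univ.sup n, fun J hJ ↦ ?_⟩
  have htop : A[((p ^ J : ℕ) : ℤ)] = ⊤ := by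
    refine eq_top_iff.2 fun a _ ↦ ?_
    rw [AddSubgroup.torsionBy.nsmul_iff]
    have hle : n a ≤ J := (Finset.le_sup (Finset.mem_univ a)).trans hJ
    obtain ⟨k, hk⟩ := Nat.exists_eq_add_of_le hle
    rw [hk, pow_add, mul_comm, mul_smul, hn a, smul_zero]
  rw [htop]
  exact Nat.card_congr (AddSubgroup.topEquiv (G := A)).toEquiv

/-- **Step 1 of the CDC road: `#T = #T[2^J]` for `J ≫ 0`.** `T = Sel♭(E/ℚ_∞)[γ+1]` sits in `H¹(ℚ_∞, E[2^∞])` (`subgroupH1 2 (ker κ)`), whose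
classes are killed by powers of `2` (`exists_pow_smul_subgroupH1_ker_eq_zero`); if `T` is finite (CDF_glob, ★★★ p812310, under the line's
binders) then `T[2^J] = T` for every large `J`. [folklore] -/
theorem exists_forall_natCard_torsionBy_endInvariants_eq (W : WeierstrassCurve ℚ) [W.IsElliptic] [W.IsGloballyMinimal]
    (κ : ZpExtension ℚ 2) (γ : absoluteGaloisGroup ℚ) (v : HeightOneSpectrum (𝓞 ℚ))
    (g : absoluteGaloisGroup (v.adicCompletion ℚ)) (c : ℕ → localPoints W (v.adicCompletion ℚ))
    [Finite (endInvariants (conjSharpFlatSelmerInfty W κ (closureEmb (K := ℚ) (v.adicCompletion ℚ))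
      (W.frobeniusTrace 2) g c .flat γ + 1))] :
    ∃ J₀ : ℕ, ∀ J : ℕ, J₀ ≤ J →
      Nat.card ((endInvariants (conjSharpFlatSelmerInfty W κ (closureEmb (K := ℚ) (v.adicCompletion ℚ))
        (W.frobeniusTrace 2) g c .flat γ + 1))[((2 ^ J : ℕ) : ℤ)]) =
      Nat.card (endInvariants (conjSharpFlatSelmerInfty W κ (closureEmb (K := ℚ) (v.adicCompletion ℚ))
        (W.frobeniusTrace 2) g c .flat γ + 1)) := by
  refine exists_forall_natCard_torsionBy_pow_eq 2 fun t ↦ ?_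
  obtain ⟨n, hn⟩ := W.exists_pow_smul_subgroupH1_ker_eq_zero κ
    (((t : endInvariants (conjSharpFlatSelmerInfty W κ (closureEmb (K := ℚ) (v.adicCompletion ℚ))
      (W.frobeniusTrace 2) g c .flat γ + 1)) : sharpFlatSelmerInfty W κ (closureEmb (K := ℚ) (v.adicCompletion ℚ))
        (W.frobeniusTrace 2) g c .flat) : W.subgroupH1 2 κ.kerSubgroup)
  refine ⟨n, Subtype.ext (Subtype.ext ?_)⟩
  rw [AddSubgroupClass.coe_nsmul, AddSubgroupClass.coe_nsmul, ZeroMemClass.coe_zero, ZeroMemClass.coe_zero]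
  exact hn

/-! ## §2 Transport of the exact-control count to the twist side -/

/-- ★ **Steps 2+3 of the CDC road: `#T[2^J] = #H¹_{𝓑_J[ψ]}(ℚ, W₂[2^J])`.** For `W/ℚ` with `GoodSS W 2`, the cyclotomic `κ` with topological
generator `γ`, `v ∋ 2`, Sprung's local data `(g, c)`, colour ♭, a level `J`, and ANY pair of mutually inverse continuous `Γ_ℚ`-intertwiners
`φ : W₂[2^J] → E[2^J](χ₋₁)`, `ψ : E[2^J](χ₋₁) → W₂[2^J]` (for the quadratic twist `W₂` of `E` by `2` one exists by tower-1's
`FlatBlindTwistSide.exists_intertwining_twist`), and any Selmer structure `𝓑` on `W₂[2^J]` which is, place by place, the TRANSPORT along `ψ` of the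
exact structure `𝓕♭ex_J` of HT-C1 (`h𝓑`): `#T[2^J] = #H¹_𝓑(ℚ, W₂[2^J])`. Proof: HT-C1 (`#T[2^J] = #H¹_{𝓕♭ex_J}`, t42) and the transport of a
Selmer group along an isomorphism (`CongruentTransfer.natCard_selmerGroup_of_transport`, X11b). The structure `𝓑` is a parameter: the
intrinsic W₂-side identifications of its local conditions (Kummer at `∞`, «dies over `(ℚ_∞)_w`» at odd `ℓ`, the transported ♭-line at `2`) are
separate dictionary statements. [cite: GreenbergLNM1716, §4 pp. 107, 122–124] [cite: MazurRubin2004, Lemma 3.5.3 (transport along an isomorphism)] -/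
theorem natCard_torsionBy_endInvariants_eq_natCard_selmerGroup_transport (W : WeierstrassCurve ℚ) [W.IsElliptic]
    [W.IsGloballyMinimal] (hss : GoodSS W 2) {κ : ZpExtension ℚ 2} (hκ : κ.IsCyclotomic) {γ : absoluteGaloisGroup ℚ}
    (hγ : κ.IsTopGenerator γ) (v : HeightOneSpectrum (𝓞 ℚ)) (hv : (2 : 𝓞 ℚ) ∈ v.asIdeal)
    (g : absoluteGaloisGroup (v.adicCompletion ℚ)) (c : ℕ → localPoints W (v.adicCompletion ℚ)) (J : ℕ)
    (W₂ : WeierstrassCurve ℚ)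
    (φ : (W₂.torsionGaloisModule ((2 ^ J : ℕ) : ℤ)).toContRepresentation →ⁱL
      (W.twistedTorsionGaloisModule 2 κ J (-1) OddBlindTwist.two_dvd_neg_one_sub_one).toContRepresentation)
    (ψ : (W.twistedTorsionGaloisModule 2 κ J (-1) OddBlindTwist.two_dvd_neg_one_sub_one).toContRepresentation →ⁱL
      (W₂.torsionGaloisModule ((2 ^ J : ℕ) : ℤ)).toContRepresentation)
    (hψφ : ∀ a, ψ (φ a) = a) (hφψ : ∀ b, φ (ψ b) = b)
    (𝓑 : SelmerStructure (W₂.torsionGaloisModule ((2 ^ J : ℕ) : ℤ)))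
    (h𝓑inl : ∀ w : InfinitePlace ℚ, 𝓑 (Sum.inl w) =
      ((W.twistedTorsionToLocalH1 2 κ J (-1) OddBlindTwist.two_dvd_neg_one_sub_one w.Completion).ker).map
        (galoisCohomology.map (ψ.restrictField w.Completion) 1))
    (h𝓑inr : ∀ v' : HeightOneSpectrum (𝓞 ℚ), 𝓑 (Sum.inr v') =
      (W.twistedSharpFlatLocalFamily 2 κ J (-1) OddBlindTwist.two_dvd_neg_one_sub_one v
        (localTowerPointsOfEmb κ (closureEmb (K := ℚ) (v.adicCompletion ℚ)) W)
        (colemanKer κ (closureEmb (K := ℚ) (v.adicCompletion ℚ)) W (W.frobeniusTrace 2) g c .flat) v').map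
        (galoisCohomology.map (ψ.restrictField (v'.adicCompletion ℚ)) 1)) :
    Nat.card ((endInvariants (conjSharpFlatSelmerInfty W κ (closureEmb (K := ℚ) (v.adicCompletion ℚ))
      (W.frobeniusTrace 2) g c .flat γ + 1))[((2 ^ J : ℕ) : ℤ)]) = Nat.card 𝓑.selmerGroup := by
  rw [OddBlindTwist.HTC1_natCard_torsionBy_endInvariants_eq_natCard_selmerGroup W hss hκ hγ v hv g c J]
  symm
  refine CongruentTransfer.natCard_selmerGroup_of_transport _ ψ φ hφψ hψφ 𝓑 fun pl ↦ ?_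
  rcases pl with w | v'
  · exact h𝓑inl w
  · exact h𝓑inr v'

end OddBlindLocal

end Summit.BirchSwinnertonDyer.BirchSwinnertonDyer.Theorems

end
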